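import Summits.RiemannHypothesis.RiemannHypothesis.Theorems.WeilFormatCCinfGramData
import Literature.NumberTheory.LFunctions.YoshidaWindowGramEntryBox
import HarnessLib

/-!
# Format C, design C∞ (E2e): the composed-Gram DOMINATION step — from checked `Q`-box tables and one rational certificate to `Γe(A·z) ≤ zᵀMz`

Route context: Fourier–Galerkin / Schur-complement certificates of Weil positivity on a window ("format C", C∞ door;
cell memo `run/shared/lean/pub/rh-explicit/rh-explicit-weil-2/gen15/E2-PLAN-v2.md` §6.9; supporting stmt-RiemannHypothesis-0098;
seat rh-explicit-weil-2).  With the Hankel-box majorant `Γe(u) = Σ_{p,p'} u_p u_{p'} Hmid(p.1,p'.1,p.2+p'.2+2) + Σ_p c_p u_p²`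
(`WeilFormatCCinfGramHankel` / `…HankelCheck`) and the door's linear map `u = A·z`, `gramMajorant_comp_linear` (`WeilFormatCCinfGramData`)
gives `Γe(Az) = zᵀQz`; `quadEntryBox` (`WeilFormatCCinfQuadBox`) boxes the entries of `Q`; `quadForm_le_of_boxes`
(`WeilFormatCCinfDomination`, p389397; used here through private local copies because its olean is not yet on the farm) replaces `Q` by a rational `M`
given the boxes and ONE rational inequality.  This file packages the three:

* `CinfCoeff.checkQuad E tab dim : Bool` — claimed `Q`-boxes `tab k k'` contain the evaluator boxes `E k k'` (`Encl.within`), `k, k' < dim`;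
* `CinfCoeff.qMid / qRad` — the claimed table as real (mid, rad) (`0` outside `k, k' < dim`); `quad_of_check` — soundness;
* `CinfCoeff.gamma_comp_le_of_boxes` — **`Γe(A·z) ≤ zᵀMz`** for every `z : Fin dim → ℝ`, from entrywise boxes `|Q − Qm| ≤ r` and the
  certificate `Σ_k ((Σ_{k'} r_{kk'} + Σ_{k'} r_{k'k})/2) z_k² ≤ zᵀ(M − Qm)z` (PsdDyadic LDLᵀ pattern on rationals).

Bookkeeping only; standard axioms; no RH claim.
-/

set_option autoImplicit false
-- `Summit.RiemannHypothesis.RiemannHypothesis.…` is the layout-mandated namespace (summit = problem name).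
set_option linter.dupNamespace false

namespace Summit.RiemannHypothesis.RiemannHypothesis.Theorems.WeilFormatC

open Literature.Analysis.ValidatedNumerics Literature.Analysis.ValidatedNumerics.NumericsMP
open Literature.NumberTheory.LFunctions.Yoshida1992 (Encl.within Encl.mem_of_within)

namespace CinfCoeff

section LocalCopies
/-! Local `private` copies of the three lemmas of `WeilFormatCCinfDomination` (p389397, ACCEPTED; its module has no farm/hub
olean at this write, so it cannot be imported — cc-s2-1 g15 / weil-10 g10 precedent; no public re-declaration). -/
variable {κ : Type*} [Fintype κ]




/-- **AM–GM absorption of an entrywise radius matrix**: for `r ≥ 0`,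
`Σ_{k,k'} r_{kk'}|z_k||z_{k'}| ≤ Σ_k ((Σ_{k'} r_{kk'} + Σ_{k'} r_{k'k})/2)·z_k²`. -/
private theorem sum_mul_mul_abs_le_sum_sq_loc (r : κ → κ → ℝ) (hr : ∀ k k', 0 ≤ r k k') (z : κ → ℝ) :
    ∑ k, ∑ k', r k k' * |z k| * |z k'| ≤ ∑ k, ((∑ k', r k k' + ∑ k', r k' k) / 2) * z k ^ 2 := by
  have hpt : ∀ k k', r k k' * |z k| * |z k'| ≤ r k k' / 2 * z k ^ 2 + r k k' / 2 * z k' ^ 2 := by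
    intro k k'
    have h2 : 2 * |z k| * |z k'| ≤ |z k| ^ 2 + |z k'| ^ 2 := two_mul_le_add_sq (|z k|) (|z k'|)
    rw [sq_abs, sq_abs] at h2
    have := hr k k'
    nlinarith
  calc ∑ k, ∑ k', r k k' * |z k| * |z k'|
      ≤ ∑ k, ∑ k', (r k k' / 2 * z k ^ 2 + r k k' / 2 * z k' ^ 2) :=
        Finset.sum_le_sum fun k _ ↦ Finset.sum_le_sum fun k' _ ↦ hpt k k'
    _ = ∑ k, ∑ k', r k k' / 2 * z k ^ 2 + ∑ k, ∑ k', r k k' / 2 * z k' ^ 2 := by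
        simp only [Finset.sum_add_distrib]
    _ = ∑ k, ∑ k', r k k' / 2 * z k ^ 2 + ∑ k, ∑ k', r k' k / 2 * z k ^ 2 := by
        congr 1
        exact Finset.sum_comm
    _ = ∑ k, ((∑ k', r k k' + ∑ k', r k' k) / 2) * z k ^ 2 := by
        rw [← Finset.sum_add_distrib]
        refine Finset.sum_congr rfl fun k _ ↦ ?_
        rw [← Finset.sum_mul, ← Finset.sum_mul, ← Finset.sum_div, ← Finset.sum_div]
        ring

/-- **Boxed form vs midpoint form**: `|Q_{kk'} − Q̂_{kk'}| ≤ r_{kk'}` gives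
`zᵀQz ≤ zᵀQ̂z + Σ_k ((Σ_{k'} r_{kk'} + Σ_{k'} r_{k'k})/2) z_k²`. -/
private theorem quadForm_le_of_abs_sub_le_loc (Q Qm r : κ → κ → ℝ) (hr : ∀ k k', |Q k k' - Qm k k'| ≤ r k k') (z : κ → ℝ) :
    ∑ k, ∑ k', z k * z k' * Q k k'
      ≤ ∑ k, ∑ k', z k * z k' * Qm k k' + ∑ k, ((∑ k', r k k' + ∑ k', r k' k) / 2) * z k ^ 2 := by
  have hr0 : ∀ k k', 0 ≤ r k k' := fun k k' ↦ (abs_nonneg _).trans (hr k k')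
  have hdiff : ∑ k, ∑ k', z k * z k' * Q k k' - ∑ k, ∑ k', z k * z k' * Qm k k'
      ≤ ∑ k, ∑ k', r k k' * |z k| * |z k'| := by
    rw [← Finset.sum_sub_distrib]
    refine Finset.sum_le_sum fun k _ ↦ ?_
    rw [← Finset.sum_sub_distrib]
    refine Finset.sum_le_sum fun k' _ ↦ ?_
    have e : z k * z k' * Q k k' - z k * z k' * Qm k k' = z k * z k' * (Q k k' - Qm k k') := by ring
    rw [e]
    calc z k * z k' * (Q k k' - Qm k k') ≤ |z k * z k' * (Q k k' - Qm k k')| := le_abs_self _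
      _ = |z k| * |z k'| * |Q k k' - Qm k k'| := by rw [abs_mul, abs_mul]
      _ ≤ |z k| * |z k'| * r k k' := mul_le_mul_of_nonneg_left (hr k k') (by positivity)
      _ = r k k' * |z k| * |z k'| := by ring
  have h := sum_mul_mul_abs_le_sum_sq_loc r hr0 z
  linarith

/-- **Domination from boxes + a rational PSD certificate**: if `|Q − Q̂| ≤ r` entrywise and
`zᵀ(M − Q̂)z ≥ Σ_k c_k z_k²` for all `z` (with `c` the AM–GM weights of `r`), then `zᵀQz ≤ zᵀMz` for all `z`.  This is the
shape in which the C∞ door's dominating `Uq` (a rational matrix `M` from the generator) absorbs the boxed Gram of the composite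
families. -/
private theorem quadForm_le_of_boxes_loc (Q Qm r M : κ → κ → ℝ) (hr : ∀ k k', |Q k k' - Qm k k'| ≤ r k k')
    (hM : ∀ z : κ → ℝ, ∑ k, ((∑ k', r k k' + ∑ k', r k' k) / 2) * z k ^ 2
      ≤ ∑ k, ∑ k', z k * z k' * (M k k' - Qm k k')) (z : κ → ℝ) :
    ∑ k, ∑ k', z k * z k' * Q k k' ≤ ∑ k, ∑ k', z k * z k' * M k k' := by
  have h1 := quadForm_le_of_abs_sub_le_loc Q Qm r hr z
  have h2 := hM z
  have e : ∑ k, ∑ k', z k * z k' * (M k k' - Qm k k')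
      = ∑ k, ∑ k', z k * z k' * M k k' - ∑ k, ∑ k', z k * z k' * Qm k k' := by
    rw [← Finset.sum_sub_distrib]
    refine Finset.sum_congr rfl fun k _ ↦ ?_
    rw [← Finset.sum_sub_distrib]
    exact Finset.sum_congr rfl fun k' _ ↦ by ring
  rw [e] at h2
  linarith


end LocalCopies

variable {S : ℕ}

/-! ## The `Q`-table checker -/

/-- Claimed `Q`-boxes contain the evaluator boxes, `k, k' < dim`. -/
def checkQuad (E tab : ℕ → ℕ → MI) (dim : ℕ) : Bool :=
  (List.range dim).all fun k ↦ (List.range dim).all fun k' ↦ Encl.within (E k k') (tab k k')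

/-- Claimed midpoint as a real number. -/
noncomputable def qMid (S : ℕ) (tab : ℕ → ℕ → MI) {dim : ℕ} (k k' : Fin dim) : ℝ :=
  (((tab k k').lo : ℝ) + (tab k k').hi) / (2 * S)

/-- Claimed radius as a real number. -/
noncomputable def qRad (S : ℕ) (tab : ℕ → ℕ → MI) {dim : ℕ} (k k' : Fin dim) : ℝ :=
  (((tab k k').hi : ℝ) - (tab k k').lo) / (2 * S)

/-- A fixed-point box as a (mid, rad) pair (local copy). -/
private theorem abs_sub_mid_le_of_mem_loc' (hS : 0 < S) {x : ℝ} {B : MI} (h : MI.mem S x B) :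
    |x - ((B.lo : ℝ) + B.hi) / (2 * S)| ≤ ((B.hi : ℝ) - B.lo) / (2 * S) := by
  have hS' : (0 : ℝ) < S := by exact_mod_cast hS
  have h1 : (B.lo : ℝ) ≤ x * S := h.1
  have h2 : x * S ≤ (B.hi : ℝ) := h.2
  have e : x - ((B.lo : ℝ) + B.hi) / (2 * S) = (2 * (x * S) - ((B.lo : ℝ) + B.hi)) / (2 * S) := by
    field_simp
  rw [e, abs_div, abs_of_pos (by positivity : (0 : ℝ) < 2 * S), div_le_div_iff_of_pos_right (by positivity),
    abs_le]
  constructor <;> linarith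

/-- **Soundness of `checkQuad`**: evaluator memberships + a passing check give `|Q k k' − qMid| ≤ qRad`. -/
theorem quad_of_check (hS : 0 < S) {dim : ℕ} {Q : Fin dim → Fin dim → ℝ} {E tab : ℕ → ℕ → MI}
    (hE : ∀ k k' : Fin dim, MI.mem S (Q k k') (E k k')) (h : checkQuad E tab dim = true) (k k' : Fin dim) :
    |Q k k' - qMid S tab k k'| ≤ qRad S tab k k' := by
  unfold checkQuad at h
  rw [List.all_eq_true] at h
  have h1 := h k (List.mem_range.2 k.isLt)
  rw [List.all_eq_true] at h1
  have h2 := h1 k' (List.mem_range.2 k'.isLt)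
  exact abs_sub_mid_le_of_mem_loc' hS (Encl.mem_of_within h2 (hE k k'))

/-! ## `Γe(A·z) ≤ zᵀMz` -/

/-- **The composed-Gram domination**: for the Hankel-box majorant `Γe(u) = Σ u u' Hmid + Σ c u²` and `u = A·z`,
entrywise boxes of the composed matrix plus one rational certificate give `Γe(A·z) ≤ zᵀMz`. -/
theorem gamma_comp_le_of_boxes {D dim : ℕ} (Hmid : Fin 4 → Fin 4 → ℕ → ℝ) (cf : Fin 4 × Fin D → ℝ)
    (Af : Fin 4 × Fin D → Fin dim → ℝ) (Qm r M : Fin dim → Fin dim → ℝ)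
    (hbox : ∀ k k' : Fin dim,
      |((∑ p : Fin 4 × Fin D, ∑ p' : Fin 4 × Fin D,
            Af p k * Af p' k' * Hmid p.1 p'.1 ((p.2 : ℕ) + (p'.2 : ℕ) + 2))
          + ∑ p : Fin 4 × Fin D, cf p * Af p k * Af p k') - Qm k k'| ≤ r k k')
    (hM : ∀ z : Fin dim → ℝ, ∑ k, ((∑ k', r k k' + ∑ k', r k' k) / 2) * z k ^ 2
      ≤ ∑ k, ∑ k', z k * z k' * (M k k' - Qm k k'))
    (z : Fin dim → ℝ) :
    (∑ p : Fin 4 × Fin D, ∑ p' : Fin 4 × Fin D, (∑ k, Af p k * z k) * (∑ k, Af p' k * z k)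
        * Hmid p.1 p'.1 ((p.2 : ℕ) + (p'.2 : ℕ) + 2))
      + ∑ p : Fin 4 × Fin D, cf p * (∑ k, Af p k * z k) ^ 2
      ≤ ∑ k, ∑ k', z k * z k' * M k k' := by
  rw [gramMajorant_comp_linear (fun p p' : Fin 4 × Fin D ↦ Hmid p.1 p'.1 ((p.2 : ℕ) + (p'.2 : ℕ) + 2)) cf Af z]
  exact quadForm_le_of_boxes_loc
    (fun k k' ↦ (∑ p : Fin 4 × Fin D, ∑ p' : Fin 4 × Fin D,
        Af p k * Af p' k' * Hmid p.1 p'.1 ((p.2 : ℕ) + (p'.2 : ℕ) + 2))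
      + ∑ p : Fin 4 × Fin D, cf p * Af p k * Af p k') Qm r M hbox hM z

/-- The same with the boxes READ OFF a checked table: `Qm := qMid`, `r := qRad` (the certificate `hM` is then one decidable
statement about rationals once `M`, `tab` are literals and `z ↦ Σ…` is put in LDLᵀ form — the PsdDyadic pattern). -/
theorem gamma_comp_le_of_check (hS : 0 < S) {D dim : ℕ} (Hmid : Fin 4 → Fin 4 → ℕ → ℝ) (cf : Fin 4 × Fin D → ℝ)
    (Af : Fin 4 × Fin D → Fin dim → ℝ) {E tab : ℕ → ℕ → MI}
    (hE : ∀ k k' : Fin dim, MI.mem S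
      ((∑ p : Fin 4 × Fin D, ∑ p' : Fin 4 × Fin D, Af p k * Af p' k' * Hmid p.1 p'.1 ((p.2 : ℕ) + (p'.2 : ℕ) + 2))
        + ∑ p : Fin 4 × Fin D, cf p * Af p k * Af p k') (E k k'))
    (hcheck : checkQuad E tab dim = true) (M : Fin dim → Fin dim → ℝ)
    (hM : ∀ z : Fin dim → ℝ, ∑ k, ((∑ k', qRad S tab k k' + ∑ k', qRad S tab k' k) / 2) * z k ^ 2
      ≤ ∑ k, ∑ k', z k * z k' * (M k k' - qMid S tab k k'))
    (z : Fin dim → ℝ) :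
    (∑ p : Fin 4 × Fin D, ∑ p' : Fin 4 × Fin D, (∑ k, Af p k * z k) * (∑ k, Af p' k * z k)
        * Hmid p.1 p'.1 ((p.2 : ℕ) + (p'.2 : ℕ) + 2))
      + ∑ p : Fin 4 × Fin D, cf p * (∑ k, Af p k * z k) ^ 2
      ≤ ∑ k, ∑ k', z k * z k' * M k k' :=
  gamma_comp_le_of_boxes Hmid cf Af (qMid S tab) (qRad S tab) M (fun k k' ↦ quad_of_check hS hE hcheck k k') hM z

end CinfCoeff

end Summit.RiemannHypothesis.RiemannHypothesis.Theorems.WeilFormatC
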